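import Summits.QuantumAdvantage.QuantumAdvantage.Theorems.DigitRung.Negative.WalshAndIndependence
import Literature.NumberTheory.QuadraticFields.ThreeTorsionMean
import Literature.NumberTheory.QuadraticFields.ThreeTorsionMeanProofs
import Mathlib.Analysis.SpecialFunctions.Pow.Asymptotics

/-!
# `DigitRung` (stmt-QuantumAdvantage-2423) — line `Sketch`, stub `stub_high`: the top digits

Crux `Summit.QuantumAdvantage.QuantumAdvantage.Theses.ArithStatLadder.DigitRung`, line `Sketch`
(skeleton `Cruxes/DigitRung/Lines/Sketch.lean`). With `t = quadFieldThreeTorsion = #Cl₃`,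
`𝒟_n = Negative.block n` and `X = 2^n`: at the TOP positions `j < n`, `7n ≤ 10j`, every digit half
`{d ∈ 𝒟_n : bit_j d = b}` has centred sum `Σ (t(−d) − 2) ≤ ε·#𝒟_n` eventually — CONDITIONAL on the
vendored named fact `btt_threeTorsion_sum` (Bhargava–Taniguchi–Thorne 2023, Thm 1.2; hypothesis).

* `sum_eq_sub_of_mem_iff` — reindexing `d ↦ D = −d`: `{u ≤ d < v, −d fundamental}` sums like
  `negFundDiscrs v` minus `negFundDiscrs u`;
* `dev_eq_sum_Ico` — a half is the union over `m ∈ [2^{n−1−j}, 2^{n−j})`, `m ≡ b (2)`, of the dyadic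
  intervals `[m2^j, (m+1)2^j)`: `dev = Σ_m (E((m+1)2^j) − E(m2^j))`, `E(u) = Σ_{negFundDiscrs u} (t − 2)`;
* `abs_centred_sub_le` — the named fact at `ε' = 1/60` minus twice the PROVED count
  `abs_card_negFundDiscrs_sub_le`: `|E(u) − K u^{5/6}| ≤ C X^{41/60} + 16√X` (`1 ≤ u ≤ X`);
* `abs_dev_le_rpow` — summing over the `≤ 2^{n−j} ≤ X^{3/10}` intervals (the `K`-increments
  telescope to `≤ X^{5/6}`): `|dev| ≤ (|K| + 2C + 32)·X^{59/60}`;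
* `card_block_ge` — `#𝒟_n ≥ X/16` for `n ≥ 18` (`π ≤ 4`); and `X^{1/60} → ∞`.
-/

noncomputable section

namespace Summit.QuantumAdvantage.DigitRung.Sketch

open scoped Classical FourierTransform
open Filter Finset
open Literature.NumberTheory.QuadraticFields
open Summit.QuantumAdvantage.DigitRung.Negative

namespace StubHigh

/-! ### Reindexing: `n`-bit blocks versus `negFundDiscrs` -/

/-- **Reindexing `d ↦ D = −d`.** A set of naturals cut out by `u ≤ d < v` and "`−d` fundamental"
sums `f(−d)` to `Σ_{negFundDiscrs v} f − Σ_{negFundDiscrs u} f`. [folklore] -/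
theorem sum_eq_sub_of_mem_iff {u v : ℕ} (huv : u ≤ v) {s : Finset ℕ}
    (hs : ∀ d, d ∈ s ↔ (u ≤ d ∧ d < v) ∧ IsNegFund d) (f : ℤ → ℝ) :
    ∑ d ∈ s, f (-(d : ℤ)) =
      (∑ D ∈ negFundDiscrs v, f D) - ∑ D ∈ negFundDiscrs u, f D := by
  have hmono : negFundDiscrs u ⊆ negFundDiscrs v := by
    intro D hD
    rw [mem_negFundDiscrs] at hD ⊢
    exact ⟨⟨by omega, hD.1.2⟩, hD.2⟩
  rw [← Finset.sum_sdiff_eq_sub hmono]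
  refine Finset.sum_nbij' (fun d => -(d : ℤ)) (fun D => (-D).toNat) ?_ ?_ ?_ ?_ ?_
  · intro d hd
    obtain ⟨⟨hud, hdv⟩, hfund⟩ := (hs d).1 hd
    have hd0 : d ≠ 0 := by
      rintro rfl
      rcases hfund with ⟨h, -, -⟩ | ⟨-, h, -⟩ <;> norm_num at h
    rw [Finset.mem_sdiff, mem_negFundDiscrs, mem_negFundDiscrs]
    exact ⟨⟨⟨by omega, by omega⟩, hfund⟩, fun h => by have := h.1.1; omega⟩
  · intro D hD
    rw [Finset.mem_sdiff, mem_negFundDiscrs, mem_negFundDiscrs] at hD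
    obtain ⟨⟨⟨hvD, hD0⟩, hfund⟩, hnot⟩ := hD
    have hcast : (((-D).toNat : ℕ) : ℤ) = -D := Int.toNat_of_nonneg (by omega)
    rw [hs]
    refine ⟨⟨?_, ?_⟩, ?_⟩
    · by_contra hlt
      exact hnot ⟨⟨by omega, hD0⟩, hfund⟩
    · omega
    · simpa only [IsNegFund, hcast, neg_neg] using hfund
  · intro d _
    simp
  · intro D hD
    rw [Finset.mem_sdiff, mem_negFundDiscrs] at hD
    have hD0 := hD.1.1.2
    rw [Int.toNat_of_nonneg (by omega), neg_neg]
  · intro d _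
    rfl

/-! ### Interval decomposition of a digit half -/

/-- **Interval decomposition of a digit half.** For `j < n`, the half `{d ∈ 𝒟_n : bit_j d = b}` is
the disjoint union over `m ∈ [2^{n−1−j}, 2^{n−j})`, `m ≡ b (mod 2)` (`m = ⌊d/2^j⌋`), of the dyadic
intervals `[m 2^j, (m+1) 2^j)` cut by fundamentality, so its centred sum is a sum of differences
of the cumulative centred sums `E(u) = Σ_{D ∈ negFundDiscrs u} (t D − 2)`. [folklore] -/
theorem dev_eq_sum_Ico (t : ℤ → ℕ) {n j : ℕ} (hj : j < n) (b : Bool) :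
    dev t n j b =
      ∑ m ∈ (Finset.Ico (2 ^ (n - 1 - j)) (2 ^ (n - j))).filter (fun m => m % 2 = b.toNat),
        ((∑ D ∈ negFundDiscrs ((m + 1) * 2 ^ j), ((t D : ℝ) - 2)) -
          ∑ D ∈ negFundDiscrs (m * 2 ^ j), ((t D : ℝ) - 2)) := by
  have hpos : 0 < 2 ^ j := Nat.two_pow_pos j
  have h1 : 2 ^ (n - 1 - j) * 2 ^ j = 2 ^ (n - 1) := by
    rw [← pow_add]; congr 1; omega
  have h2 : 2 ^ (n - j) * 2 ^ j = 2 ^ n := by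
    rw [← pow_add]; congr 1; omega
  have hbit : ∀ d : ℕ, Nat.testBit d j = b ↔ d / 2 ^ j % 2 = b.toNat := by
    intro d
    rw [Nat.testBit_eq_decide_div_mod_eq]
    cases b
    · simp only [Bool.toNat_false, decide_eq_false_iff_not]
      omega
    · simp only [Bool.toNat_true, decide_eq_true_eq]
  have hmaps : ∀ d ∈ half n j b,
      d / 2 ^ j ∈ (Finset.Ico (2 ^ (n - 1 - j)) (2 ^ (n - j))).filter
        (fun m => m % 2 = b.toNat) := by
    intro d hd
    rw [mem_half, mem_block, hbit] at hd
    obtain ⟨⟨⟨hlo, hhi⟩, -⟩, hb⟩ := hd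
    rw [Finset.mem_filter, Finset.mem_Ico, Nat.le_div_iff_mul_le hpos, Nat.div_lt_iff_lt_mul hpos,
      h1, h2]
    exact ⟨⟨hlo, hhi⟩, hb⟩
  unfold dev
  rw [← Finset.sum_fiberwise_of_maps_to hmaps]
  refine Finset.sum_congr rfl fun m hm => ?_
  rw [Finset.mem_filter, Finset.mem_Ico] at hm
  obtain ⟨⟨hm1, hm2⟩, hmb⟩ := hm
  have hdiv : ∀ d : ℕ, d / 2 ^ j = m ↔ m * 2 ^ j ≤ d ∧ d < (m + 1) * 2 ^ j := by
    intro d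
    rw [le_antisymm_iff, ← Nat.lt_succ_iff, Nat.div_lt_iff_lt_mul hpos,
      Nat.le_div_iff_mul_le hpos]
    exact and_comm
  refine sum_eq_sub_of_mem_iff (Nat.mul_le_mul_right _ (Nat.le_succ m)) (fun d => ?_)
    (fun D => (t D : ℝ) - 2)
  -- the fibre over `m` is the dyadic interval `[m 2^j, (m+1) 2^j)` cut by fundamentality
  rw [Finset.mem_filter, mem_half, mem_block, hbit, hdiv]
  constructor
  · rintro ⟨⟨⟨-, hfund⟩, -⟩, hI⟩
    exact ⟨hI, hfund⟩
  · rintro ⟨⟨hlo, hhi⟩, hfund⟩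
    refine ⟨⟨⟨⟨?_, ?_⟩, hfund⟩, ?_⟩, hlo, hhi⟩
    · calc 2 ^ (n - 1) = 2 ^ (n - 1 - j) * 2 ^ j := h1.symm
        _ ≤ m * 2 ^ j := Nat.mul_le_mul_right _ hm1
        _ ≤ d := hlo
    · calc d < (m + 1) * 2 ^ j := hhi
        _ ≤ 2 ^ (n - j) * 2 ^ j := Nat.mul_le_mul_right _ hm2
        _ = 2 ^ n := h2
    · rw [(hdiv d).2 ⟨hlo, hhi⟩]
      exact hmb

/-! ### The two-term asymptotic, centred and differenced -/

/-- From `|S(u) − (6/π²)u − K u^{5/6}| ≤ C u^e` and the proved count `|N(u) − (3/π²)u| ≤ 8√u`: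
the centred cumulative sum `E(u) = S(u) − 2N(u)` satisfies, for `1 ≤ u ≤ X`,
`|E(u) − K u^{5/6}| ≤ C X^e + 16√X`. [folklore] -/
theorem abs_centred_sub_le {K C e : ℝ}
    (hC : ∀ X : ℕ, 1 ≤ X →
      |(∑ D ∈ negFundDiscrs X, (quadFieldThreeTorsion D : ℝ)) - 6 / Real.pi ^ 2 * X
          - K * (X : ℝ) ^ ((5 : ℝ) / 6)| ≤ C * (X : ℝ) ^ e)
    (hC0 : 0 ≤ C) (he : 0 ≤ e) {u X : ℕ} (hu : 1 ≤ u) (huX : u ≤ X) :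
    |(∑ D ∈ negFundDiscrs u, ((quadFieldThreeTorsion D : ℝ) - 2)) - K * (u : ℝ) ^ ((5 : ℝ) / 6)|
      ≤ C * (X : ℝ) ^ e + 16 * Real.sqrt X := by
  have h1 := hC u hu
  have h2 := abs_card_negFundDiscrs_sub_le u
  have huX' : (u : ℝ) ≤ X := by exact_mod_cast huX
  have hr : C * (u : ℝ) ^ e ≤ C * (X : ℝ) ^ e :=
    mul_le_mul_of_nonneg_left (Real.rpow_le_rpow (Nat.cast_nonneg _) huX' he) hC0
  have hs : Real.sqrt u ≤ Real.sqrt X := Real.sqrt_le_sqrt huX'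
  rw [Finset.sum_sub_distrib, Finset.sum_const, nsmul_eq_mul]
  have key : (∑ D ∈ negFundDiscrs u, (quadFieldThreeTorsion D : ℝ)) -
        ((negFundDiscrs u).card : ℝ) * 2 - K * (u : ℝ) ^ ((5 : ℝ) / 6) =
      ((∑ D ∈ negFundDiscrs u, (quadFieldThreeTorsion D : ℝ)) - 6 / Real.pi ^ 2 * u
          - K * (u : ℝ) ^ ((5 : ℝ) / 6)) -
        2 * (((negFundDiscrs u).card : ℝ) - 3 / Real.pi ^ 2 * u) := by
    ring
  rw [key]
  refine (abs_sub _ _).trans ?_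
  rw [abs_mul, abs_two]
  linarith

/-- Bookkeeping: `|b − a| ≤ |K|·(y − x) + (q + p)` from `|a − K x| ≤ p`, `|b − K y| ≤ q`, `x ≤ y`.
[folklore] -/
theorem abs_sub_le_of_abs_sub_mul_le {a b x y K p q : ℝ} (hxy : x ≤ y) (ha : |a - K * x| ≤ p)
    (hb : |b - K * y| ≤ q) : |b - a| ≤ |K| * (y - x) + (q + p) := by
  calc |b - a| = |K * (y - x) + ((b - K * y) - (a - K * x))| := by congr 1; ring
    _ ≤ |K * (y - x)| + |(b - K * y) - (a - K * x)| := abs_add_le _ _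
    _ ≤ |K| * (y - x) + (|b - K * y| + |a - K * x|) := by
        rw [abs_mul, abs_of_nonneg (sub_nonneg.2 hxy)]
        exact add_le_add le_rfl (abs_sub _ _)
    _ ≤ |K| * (y - x) + (q + p) := by linarith

/-- The increments of `u ↦ u^{5/6}` over the dyadic intervals indexed by `T ⊆ [0, 2^{n−j})` add up
to at most `(2^n)^{5/6}` (telescoping over all of `[0, 2^{n−j})`). [folklore] -/
theorem sum_incr_le {n j : ℕ} (hj : j ≤ n) {T : Finset ℕ} (hT : T ⊆ Finset.range (2 ^ (n - j))) :
    ∑ m ∈ T, ((((m + 1) * 2 ^ j : ℕ) : ℝ) ^ ((5 : ℝ) / 6) - ((m * 2 ^ j : ℕ) : ℝ) ^ ((5 : ℝ) / 6))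
      ≤ ((2 : ℝ) ^ n) ^ ((5 : ℝ) / 6) := by
  have hnonneg : ∀ m : ℕ,
      0 ≤ (((m + 1) * 2 ^ j : ℕ) : ℝ) ^ ((5 : ℝ) / 6) - ((m * 2 ^ j : ℕ) : ℝ) ^ ((5 : ℝ) / 6) := by
    intro m
    rw [sub_nonneg]
    exact Real.rpow_le_rpow (Nat.cast_nonneg _)
      (by exact_mod_cast Nat.mul_le_mul_right _ (Nat.le_succ m)) (by norm_num)
  refine (Finset.sum_le_sum_of_subset_of_nonneg hT (fun m _ _ => hnonneg m)).trans ?_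
  refine (Finset.sum_range_sub (fun m => ((m * 2 ^ j : ℕ) : ℝ) ^ ((5 : ℝ) / 6)) _).le.trans ?_
  rw [← pow_add, Nat.sub_add_cancel hj, zero_mul, Nat.cast_zero, Real.zero_rpow (by norm_num),
    sub_zero]
  norm_num

/-- Summing the differenced asymptotic over the admissible `m`: every digit half at `j < n` has
`|dev| ≤ |K|·X^{5/6} + 2^{n−j}·2(C X^e + 16√X)`, `X = 2^n`. [folklore] -/
theorem abs_dev_le {K C e : ℝ}
    (hC : ∀ X : ℕ, 1 ≤ X →
      |(∑ D ∈ negFundDiscrs X, (quadFieldThreeTorsion D : ℝ)) - 6 / Real.pi ^ 2 * X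
          - K * (X : ℝ) ^ ((5 : ℝ) / 6)| ≤ C * (X : ℝ) ^ e)
    (hC0 : 0 ≤ C) (he : 0 ≤ e) {n j : ℕ} (hj : j < n) (b : Bool) :
    |dev quadFieldThreeTorsion n j b| ≤
      |K| * ((2 : ℝ) ^ n) ^ ((5 : ℝ) / 6) +
        (2 : ℝ) ^ (n - j) * (2 * (C * ((2 : ℝ) ^ n) ^ e + 16 * Real.sqrt ((2 : ℝ) ^ n))) := by
  rw [dev_eq_sum_Ico _ hj b]
  set T := (Finset.Ico (2 ^ (n - 1 - j)) (2 ^ (n - j))).filter (fun m => m % 2 = b.toNat)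
    with hT
  have hX : ((2 ^ n : ℕ) : ℝ) = (2 : ℝ) ^ n := by norm_num
  have hTsub : T ⊆ Finset.range (2 ^ (n - j)) := by
    intro m hm
    rw [hT, Finset.mem_filter, Finset.mem_Ico] at hm
    exact Finset.mem_range.mpr hm.1.2
  have hTcard : (T.card : ℝ) ≤ (2 : ℝ) ^ (n - j) := by
    have h := Finset.card_le_card hTsub
    rw [Finset.card_range] at h
    exact_mod_cast h
  have hB0 : 0 ≤ 2 * (C * ((2 : ℝ) ^ n) ^ e + 16 * Real.sqrt ((2 : ℝ) ^ n)) := by positivity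
  have hterm : ∀ m ∈ T,
      |(∑ D ∈ negFundDiscrs ((m + 1) * 2 ^ j), ((quadFieldThreeTorsion D : ℝ) - 2)) -
          ∑ D ∈ negFundDiscrs (m * 2 ^ j), ((quadFieldThreeTorsion D : ℝ) - 2)| ≤
        |K| * ((((m + 1) * 2 ^ j : ℕ) : ℝ) ^ ((5 : ℝ) / 6) - ((m * 2 ^ j : ℕ) : ℝ) ^ ((5 : ℝ) / 6))
          + 2 * (C * ((2 : ℝ) ^ n) ^ e + 16 * Real.sqrt ((2 : ℝ) ^ n)) := by
    intro m hm
    rw [hT, Finset.mem_filter, Finset.mem_Ico] at hm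
    have hm0 : 0 < m := lt_of_lt_of_le (Nat.two_pow_pos _) hm.1.1
    have hu : 1 ≤ m * 2 ^ j := Nat.mul_pos hm0 (Nat.two_pow_pos j)
    have huv : m * 2 ^ j ≤ (m + 1) * 2 ^ j := Nat.mul_le_mul_right _ (Nat.le_succ m)
    have hvX : (m + 1) * 2 ^ j ≤ 2 ^ n := by
      calc (m + 1) * 2 ^ j ≤ 2 ^ (n - j) * 2 ^ j := Nat.mul_le_mul_right _ hm.1.2
        _ = 2 ^ n := by rw [← pow_add, Nat.sub_add_cancel hj.le]
    have h := abs_sub_le_of_abs_sub_mul_le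
      (Real.rpow_le_rpow (Nat.cast_nonneg _) (by exact_mod_cast huv) (by norm_num))
      (abs_centred_sub_le hC hC0 he hu (huv.trans hvX))
      (abs_centred_sub_le hC hC0 he (hu.trans huv) hvX)
    rwa [hX, ← two_mul] at h
  refine (Finset.abs_sum_le_sum_abs _ _).trans ?_
  refine (Finset.sum_le_sum hterm).trans ?_
  rw [Finset.sum_add_distrib, ← Finset.mul_sum, Finset.sum_const, nsmul_eq_mul]
  have h1 := mul_le_mul_of_nonneg_left (sum_incr_le hj.le hTsub) (abs_nonneg K)
  have h2 : (T.card : ℝ) * (2 * (C * ((2 : ℝ) ^ n) ^ e + 16 * Real.sqrt ((2 : ℝ) ^ n))) ≤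
      (2 : ℝ) ^ (n - j) * (2 * (C * ((2 : ℝ) ^ n) ^ e + 16 * Real.sqrt ((2 : ℝ) ^ n))) :=
    mul_le_mul_of_nonneg_right hTcard hB0
  linarith

/-! ### The top digits -/

/-- **The top-digit estimate.** For `j < n` with `7n ≤ 10j` (so that `2^{n−j} ≤ X^{3/10}`):
`|dev| ≤ (|K| + 2C + 32)·X^{59/60}`, `C` the Bhargava–Taniguchi–Thorne constant at `ε' = 1/60`,
`X = 2^n`. [folklore] -/
theorem abs_dev_le_rpow {K C : ℝ}
    (hC : ∀ X : ℕ, 1 ≤ X →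
      |(∑ D ∈ negFundDiscrs X, (quadFieldThreeTorsion D : ℝ)) - 6 / Real.pi ^ 2 * X
          - K * (X : ℝ) ^ ((5 : ℝ) / 6)| ≤ C * (X : ℝ) ^ ((2 : ℝ) / 3 + 1 / 60))
    (hC0 : 0 ≤ C) {n j : ℕ} (hj : j < n) (hjn : 7 * n ≤ 10 * j) (b : Bool) :
    |dev quadFieldThreeTorsion n j b| ≤ (|K| + 2 * C + 32) * ((2 : ℝ) ^ n) ^ ((59 : ℝ) / 60) := by
  have h := abs_dev_le hC hC0 (by norm_num) hj b
  have hX1 : (1 : ℝ) ≤ 2 ^ n := one_le_pow₀ (by norm_num)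
  have hXpos : (0 : ℝ) < 2 ^ n := by positivity
  have hP : (2 : ℝ) ^ (n - j) ≤ ((2 : ℝ) ^ n) ^ ((3 : ℝ) / 10) := by
    rw [← Real.rpow_natCast 2 n, ← Real.rpow_mul (by norm_num : (0 : ℝ) ≤ 2),
      ← Real.rpow_natCast 2 (n - j)]
    apply Real.rpow_le_rpow_of_exponent_le (by norm_num : (1 : ℝ) ≤ 2)
    rw [Nat.cast_sub hj.le]
    have h' : (7 : ℝ) * n ≤ 10 * j := by exact_mod_cast hjn
    linarith
  have h1 : ((2 : ℝ) ^ n) ^ ((5 : ℝ) / 6) ≤ ((2 : ℝ) ^ n) ^ ((59 : ℝ) / 60) :=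
    Real.rpow_le_rpow_of_exponent_le hX1 (by norm_num)
  have h2 : (2 : ℝ) ^ (n - j) * ((2 : ℝ) ^ n) ^ ((2 : ℝ) / 3 + 1 / 60) ≤
      ((2 : ℝ) ^ n) ^ ((59 : ℝ) / 60) := by
    calc (2 : ℝ) ^ (n - j) * ((2 : ℝ) ^ n) ^ ((2 : ℝ) / 3 + 1 / 60)
        ≤ ((2 : ℝ) ^ n) ^ ((3 : ℝ) / 10) * ((2 : ℝ) ^ n) ^ ((2 : ℝ) / 3 + 1 / 60) :=
          mul_le_mul_of_nonneg_right hP (Real.rpow_nonneg hXpos.le _)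
      _ = ((2 : ℝ) ^ n) ^ ((59 : ℝ) / 60) := by
          rw [← Real.rpow_add hXpos]
          norm_num
  have h3 : (2 : ℝ) ^ (n - j) * Real.sqrt ((2 : ℝ) ^ n) ≤ ((2 : ℝ) ^ n) ^ ((59 : ℝ) / 60) := by
    calc (2 : ℝ) ^ (n - j) * Real.sqrt ((2 : ℝ) ^ n)
        ≤ ((2 : ℝ) ^ n) ^ ((3 : ℝ) / 10) * Real.sqrt ((2 : ℝ) ^ n) :=
          mul_le_mul_of_nonneg_right hP (Real.sqrt_nonneg _)
      _ = ((2 : ℝ) ^ n) ^ ((4 : ℝ) / 5) := by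
          rw [Real.sqrt_eq_rpow, ← Real.rpow_add hXpos]
          norm_num
      _ ≤ ((2 : ℝ) ^ n) ^ ((59 : ℝ) / 60) := Real.rpow_le_rpow_of_exponent_le hX1 (by norm_num)
  have h1' := mul_le_mul_of_nonneg_left h1 (abs_nonneg K)
  have h2' := mul_le_mul_of_nonneg_left h2 (by linarith : (0 : ℝ) ≤ 2 * C)
  calc |dev quadFieldThreeTorsion n j b|
      ≤ |K| * ((2 : ℝ) ^ n) ^ ((5 : ℝ) / 6) +
        (2 : ℝ) ^ (n - j) * (2 * (C * ((2 : ℝ) ^ n) ^ ((2 : ℝ) / 3 + 1 / 60) +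
          16 * Real.sqrt ((2 : ℝ) ^ n))) := h
    _ = |K| * ((2 : ℝ) ^ n) ^ ((5 : ℝ) / 6) +
        2 * C * ((2 : ℝ) ^ (n - j) * ((2 : ℝ) ^ n) ^ ((2 : ℝ) / 3 + 1 / 60)) +
        32 * ((2 : ℝ) ^ (n - j) * Real.sqrt ((2 : ℝ) ^ n)) := by ring
    _ ≤ |K| * ((2 : ℝ) ^ n) ^ ((59 : ℝ) / 60) + 2 * C * ((2 : ℝ) ^ n) ^ ((59 : ℝ) / 60) +
        32 * ((2 : ℝ) ^ n) ^ ((59 : ℝ) / 60) := by linarith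
    _ = (|K| + 2 * C + 32) * ((2 : ℝ) ^ n) ^ ((59 : ℝ) / 60) := by ring

/-- **Blocks are large.** `#𝒟_n ≥ 2^n / 16` for `n ≥ 18`: `#𝒟_n = N(2^n) − N(2^{n−1})` by reindexing,
`N(X) = #negFundDiscrs X = (3/π²)X + O(8√X)` (proved), and `π ≤ 4`. [folklore] -/
theorem card_block_ge {n : ℕ} (hn : 18 ≤ n) : (2 : ℝ) ^ n / 16 ≤ ((block n).card : ℝ) := by
  have hcard : ((block n).card : ℝ) =
      ((negFundDiscrs (2 ^ n)).card : ℝ) - ((negFundDiscrs (2 ^ (n - 1))).card : ℝ) := by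
    simpa using sum_eq_sub_of_mem_iff (Nat.pow_le_pow_right two_pos (Nat.sub_le n 1))
      (s := block n) (fun d => mem_block) (fun _ => (1 : ℝ))
  have h1 := abs_card_negFundDiscrs_sub_le (2 ^ n)
  have h2 := abs_card_negFundDiscrs_sub_le (2 ^ (n - 1))
  rw [abs_le] at h1 h2
  push_cast at h1 h2
  have hXpos : (0 : ℝ) < 2 ^ n := by positivity
  have hhalf : (2 : ℝ) ^ (n - 1) = 2 ^ n / 2 := by
    rw [eq_div_iff two_ne_zero, ← pow_succ, Nat.sub_add_cancel (by omega : 1 ≤ n)]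
  rw [hhalf] at h2
  have hpi : (3 : ℝ) / 16 ≤ 3 / Real.pi ^ 2 :=
    div_le_div_of_nonneg_left (by norm_num) (by positivity)
      (by nlinarith [Real.pi_le_four, Real.pi_pos])
  have hcX : (3 : ℝ) / 16 * 2 ^ n ≤ 3 / Real.pi ^ 2 * 2 ^ n :=
    mul_le_mul_of_nonneg_right hpi hXpos.le
  have hsmono : Real.sqrt (2 ^ n / 2) ≤ Real.sqrt (2 ^ n) := Real.sqrt_le_sqrt (by linarith)
  have hs : (512 : ℝ) ≤ Real.sqrt (2 ^ n) := by
    rw [Real.le_sqrt' (by norm_num : (0 : ℝ) < 512)]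
    calc (512 : ℝ) ^ 2 = 2 ^ 18 := by norm_num
      _ ≤ 2 ^ n := pow_le_pow_right₀ (by norm_num) hn
  have hss : Real.sqrt (2 ^ n) * Real.sqrt (2 ^ n) = 2 ^ n := Real.mul_self_sqrt hXpos.le
  have h512 : 512 * Real.sqrt (2 ^ n) ≤ 2 ^ n := by
    nlinarith [Real.sqrt_nonneg ((2 : ℝ) ^ n)]
  rw [hcard]
  linarith [h1.1, h2.2]

end StubHigh

open StubHigh in
/-- **Stub (top digits).** From the Bhargava–Taniguchi–Thorne two-term asymptotic
(`btt_threeTorsion_sum`, hypothesis): at the positions `j < n` with `7n ≤ 10j` every digit half has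
centred `#Cl₃`-sum `≤ ε·#𝒟_n`, eventually in `n`. Each half is a union of `≤ 2^{n−j} ≤ X^{3/10}`
dyadic intervals of length `2^j`; on each, the asymptotic differenced against the proved count
`abs_card_negFundDiscrs_sub_le` leaves `O(X^{2/3+1/60})`, and the secondary terms telescope to
`≤ |K|·X^{5/6}`; in total `O(X^{59/60}) = o(#𝒟_n)`. [folklore] -/
theorem stub_high (hbtt : btt_threeTorsion_sum) :
    ∀ ε : ℝ, 0 < ε → ∀ᶠ n : ℕ in atTop, ∀ j < n, 7 * n ≤ 10 * j → ∀ b : Bool,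
      |dev quadFieldThreeTorsion n j b| ≤ ε * ((block n).card : ℝ) := by
  intro ε hε
  obtain ⟨K, hK⟩ := hbtt.neg
  obtain ⟨C, hC⟩ := hK (1 / 60) (by norm_num)
  have hC0 : 0 ≤ C := by
    have h := hC 1 le_rfl
    simp only [Nat.cast_one, Real.one_rpow, mul_one] at h
    exact (abs_nonneg _).trans h
  have htend : Tendsto (fun n : ℕ => ((2 : ℝ) ^ n) ^ ((1 : ℝ) / 60)) atTop atTop :=
    (tendsto_rpow_atTop (by norm_num)).comp (tendsto_pow_atTop_atTop_of_one_lt one_lt_two)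
  filter_upwards [htend.eventually_ge_atTop (16 * (|K| + 2 * C + 32) / ε),
    eventually_ge_atTop 18] with n hn hn18 j hj hjn b
  have hXpos : (0 : ℝ) < 2 ^ n := by positivity
  have hLe : |K| + 2 * C + 32 ≤ ε / 16 * ((2 : ℝ) ^ n) ^ ((1 : ℝ) / 60) := by
    rw [div_le_iff₀ hε] at hn
    linarith
  have hsplit : ((2 : ℝ) ^ n) ^ ((1 : ℝ) / 60) * ((2 : ℝ) ^ n) ^ ((59 : ℝ) / 60) = 2 ^ n := by
    rw [← Real.rpow_add hXpos]
    norm_num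
  calc |dev quadFieldThreeTorsion n j b|
      ≤ (|K| + 2 * C + 32) * ((2 : ℝ) ^ n) ^ ((59 : ℝ) / 60) := abs_dev_le_rpow hC hC0 hj hjn b
    _ ≤ (ε / 16 * ((2 : ℝ) ^ n) ^ ((1 : ℝ) / 60)) * ((2 : ℝ) ^ n) ^ ((59 : ℝ) / 60) :=
        mul_le_mul_of_nonneg_right hLe (Real.rpow_nonneg hXpos.le _)
    _ = ε * (2 ^ n / 16) := by
        rw [mul_assoc, hsplit]
        ring
    _ ≤ ε * ((block n).card : ℝ) := mul_le_mul_of_nonneg_left (card_block_ge hn18) hε.le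

end Summit.QuantumAdvantage.DigitRung.Sketch

end
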